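import Summits.ABC.ABC.Theses.DefiniteXi
import Summits.ABC.ABC.Theorems.DefiniteXiDefiniteRTControlPrimeOfTakahashi
import Summits.ABC.ABC.Theorems.DefiniteXiDefiniteRTControlPrimeTwoFacts
import Summits.ABC.ABC.Theorems.IsogenyGlueCongruenceMazurKenkuBoundOfRadius
import Summits.ABC.ABC.Theorems.IsogenyGlueCongruenceMazurKenkuBoundSplitGlue
import Summits.ABC.ABC.Theorems.IsogenyGlueCongruenceKenkuCompositeTables
import Summits.ABC.ABC.Theorems.IsogenyGlueCongruenceKenkuLevelFortyNine
import Summits.ABC.ABC.Theorems.IsogenyGlueCongruenceKenkuPrintedLevelsOfThreeLevels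
import Literature.NumberTheory.EllipticCurves.ManinConstantArbitraryParametrizationIntegralProofs
import Literature.NumberTheory.EllipticCurves.RationalIsogenyDegrees
import Literature.NumberTheory.EllipticCurves.MasserWustholzSurjectivity
import HarnessLib

/-!
# STUB-IDEAS k1 · gen 27 companion — typed doors for `stub_pasten163` (re-elaborated 2026-09-01)
Crux stmt-ABC-11338 `DefiniteXi.DefiniteRTControlPrime`; stub signature
`PastenShimura2024_minimalDegree_le_163_mul`. Scratch of an ideation seat: every declaration is a one-line
import of a LANDED theorem; zero `sorry`. Doors D0–D6 / I1 are the gen-20 doors re-checked; NEW at gen 27: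
I2 (`crux_of_two_facts`, the only landed consumer of the stub), T4a/T4b (the transcendence door:
the tree's Masser–Wüstholz-named isogeny bound over `ℚ` is itself CONDITIONAL on Mazur–Kenku, and the
vendored effective open-image fact is height-dependent), and the axiom audits.
-/

set_option linter.dupNamespace false

namespace Summit.ABC.ABC.Cruxes.DefiniteRTControlPrime.StubIdeasK1G27

open WeierstrassCurve
open Literature.NumberTheory.EllipticCurves Literature.NumberTheory.EllipticCurves.ModularForms

/-- D0 · TREE MATCH: the stub is route item `MazurKenkuBound` verbatim (both route copies). -/
theorem door_item_defeq :
    Summit.ABC.ABC.Theses.DefiniteXi.MazurKenkuBound ↔ PastenShimura2024_minimalDegree_le_163_mul :=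
  Iff.rfl

theorem door_item_defeq' :
    Summit.ABC.ABC.Theses.IsogenyGlueCongruence.MazurKenkuBound ↔
      PastenShimura2024_minimalDegree_le_163_mul :=
  Iff.rfl

/-- D1 · import from item stmt-ABC-15125. -/
theorem stub_pasten163_of_item (h : Summit.ABC.ABC.Theses.IsogenyGlueCongruence.MazurKenkuBound) :
    PastenShimura2024_minimalDegree_le_163_mul := h

/-- D2 · import from the RADIUS item stmt-ABC-15193 (Edixhoven integrality discharged in tree). -/
theorem stub_pasten163_of_radius
    (hRad : Summit.ABC.ABC.Theses.RibetTakahashiSplit.MazurKenkuRadius) :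
    PastenShimura2024_minimalDegree_le_163_mul :=
  Summit.ABC.ABC.Theorems.mazurKenkuBound_of_radiusItem hRad

/-- D3 · import from the Literature named fact (Mazur 1978 Thm 1 + Kenku 1982; no `_holds`). -/
theorem stub_pasten163_of_fact (hMK : mazurKenku_exists_cyclic_isogeny) :
    PastenShimura2024_minimalDegree_le_163_mul :=
  PastenShimura2024_minimalDegree_le_163_mul_of_mazurKenku' hMK

/-- D5 · import from the two OPEN split children of stmt-ABC-15125 (route IsogenyGlueCongruence):
`MazurCor44` (stmt-ABC-18223) and `KenkuPrintedLevels` (stmt-ABC-18224); the other children are PROVED. -/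
theorem stub_pasten163_of_split
    (h44 : Summit.ABC.ABC.Theses.IsogenyGlueCongruence.MazurCor44)
    (hK : Summit.ABC.ABC.Theses.IsogenyGlueCongruence.KenkuPrintedLevels) :
    PastenShimura2024_minimalDegree_le_163_mul :=
  Summit.ABC.ABC.Theorems.mazurKenkuBoundGlue_proof h44 hK
    Summit.ABC.ABC.Theorems.kenkuCompositeTables_proof
    Summit.ABC.ABC.Theorems.kenkuLevelFortyNine_proof

/-- D6 · finest typed import map: Mazur Cor. 4.4 (stmt-ABC-18223), Klein–Fricke at `13` (cite-only fact),
the seven prime `j`-tables, the three levels `65, 125, 169`. -/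
theorem stub_pasten163_of_threeLevels
    (h44 : Summit.ABC.ABC.Theses.IsogenyGlueCongruence.MazurCor44)
    (h13 : kleinFrickeThirteen_exists_j_eq)
    (hT7 : ∀ (V V' : WeierstrassCurve ℚ) [V.IsElliptic] [V'.IsElliptic] (ψ : Isogeny V V'),
      ψ.IsCyclic → ψ.degree ∈ ({11, 17, 19, 37, 43, 67, 163} : Finset ℕ) →
        (ψ.degree, V.j) ∈ ({((11 : ℕ), (-32768 : ℚ)), (11, -121), (11, -24729001),
          (17, -297756989 / 2), (17, -882216989 / 131072), (19, -884736), (37, -9317),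
          (37, -162677523113838677), (43, -884736000), (67, -147197952000),
          (163, -262537412640768000)} : Finset (ℕ × ℚ)))
    (hL3 : ∀ (V V' : WeierstrassCurve ℚ) [V.IsElliptic] [V'.IsElliptic] (ψ : Isogeny V V'),
      ψ.IsCyclic → ψ.degree ∉ ({65, 125, 169} : Finset ℕ)) :
    PastenShimura2024_minimalDegree_le_163_mul :=
  Summit.ABC.ABC.Theorems.mazurKenkuBound_of_cor44_of_kleinFricke13_of_primeTables_of_threeLevels
    h44 h13 hT7 hL3

/-- I1 · IDLENESS: the crux BY NAME from Takahashi 2001 Thm 2.3 (coprime form) ALONE (landed p839521). -/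
theorem crux_of_takahashi :
    takahashi2001_thm_2_3_of_coprime → Summit.ABC.ABC.Theses.DefiniteXi.DefiniteRTControlPrime :=
  Summit.ABC.ABC.Theorems.DefiniteRTControlPrime.definiteRTControlPrime_of_takahashi

/-- I2 · the ONLY landed consumer of the stub: the crux from the two facts (landed p838145) — this is the
composition of the unregistered candidate `Lines/TwoFacts.lean`. -/
theorem crux_of_two_facts (hT : takahashi2001_thm_2_3_of_coprime)
    (h163 : PastenShimura2024_minimalDegree_le_163_mul) :
    Summit.ABC.ABC.Theses.DefiniteXi.DefiniteRTControlPrime :=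
  Summit.ABC.ABC.Theorems.DefiniteRTControlPrime.definiteRTControlPrime_of_two_facts hT h163

/-- I3 · why the stub is idle: the unconditional sub-polynomial isogeny radius of the Frey class. -/
theorem freyRadius : Summit.ABC.ABC.Theorems.DefiniteRTControlPrime.OfTakahashi.FreyIsogenyRadiusSubpoly :=
  Summit.ABC.ABC.Theorems.DefiniteRTControlPrime.OfTakahashi.freyIsogenyRadiusSubpoly

/-! T4 · the transcendence door (Masser–Wüstholz 1990 / Pellarin / Gaudron–Rémond isogeny estimates). -/

/-- T4a · the tree's Masser–Wüstholz-NAMED bound over `ℚ` (`κ = 0`, `c = 163`) takes Mazur–Kenku as its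
hypothesis — circular for this stub (verbatim restatement of `masserWustholz_naiveHeight_rat`). -/
theorem mw_named_bound_of_mazurKenku (h : mazurKenku_exists_cyclic_isogeny) :
    ∃ κ c : ℝ, ∀ (A B A' B' : ℤ), 4 * A ^ 3 + 27 * B ^ 2 ≠ 0 → 4 * A' ^ 3 + 27 * B' ^ 2 ≠ 0 →
      WeierstrassCurve.IsIsogenous (⟨0, 0, 0, (A : ℚ), (B : ℚ)⟩ : WeierstrassCurve ℚ)
        ⟨0, 0, 0, (A' : ℚ), (B' : ℚ)⟩ →
      ∃ φ : WeierstrassCurve.Isogeny (⟨0, 0, 0, (A : ℚ), (B : ℚ)⟩ : WeierstrassCurve ℚ)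
        ⟨0, 0, 0, (A' : ℚ), (B' : ℚ)⟩,
        (φ.degree : ℝ) ≤ c * (max 1 (Real.log (max |(A : ℝ)| |(B : ℝ)|))) ^ κ :=
  masserWustholz_naiveHeight_rat h

/-- T4b · the vendored transcendence fact is the effective open image (height-dependent threshold,
non-CM only): it exists as a named `Prop`, no `_holds`. -/
example : Prop := masserWustholz_surjective_modEll

#print axioms stub_pasten163_of_split
#print axioms stub_pasten163_of_threeLevels
#print axioms crux_of_takahashi
#print axioms crux_of_two_facts
#print axioms freyRadius

end Summit.ABC.ABC.Cruxes.DefiniteRTControlPrime.StubIdeasK1G27
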